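import Summits.BirchSwinnertonDyer.BirchSwinnertonDyer.Theorems.GenusKolyvaginAtTwoKolyvaginRelationAtTwoLemma43
import Summits.BirchSwinnertonDyer.BirchSwinnertonDyer.Theorems.ErratumRoadFiveNonSurjCornerKolyJProp44StandingInputs
import Summits.BirchSwinnertonDyer.BirchSwinnertonDyer.Theorems.ClassRecordThreeEulerHalvesAtThreeKolyvaginClassTamagawaFreePlace
import Summits.BirchSwinnertonDyer.BirchSwinnertonDyer.Theorems.ClassRecordThreeCornerAtThreeMilneTamagawaHolds
import Summits.BirchSwinnertonDyer.Rank1Residual.Partition.TamagawaHeegnerAnyPrime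
import Summits.BirchSwinnertonDyer.Rank1Residual.X11b.KolyvaginPointInertia
import Summits.BirchSwinnertonDyer.Rank1Residual.X11b.KolyvaginHpointsAssembly
import HarnessLib

/-!
# Route ByReductionTypeAtTwo, crux `RankOneAtTwoBigImageOddLocal` (stmt-BirchSwinnertonDyer-23715), LINE v8.10 `one_door_analytic`:
# GROSS 6.2 (1) / McCALLUM LEMMA 4.3 OVER `K` AT `p = 2` ON THE ODD-TAMAGAWA SLICE — Kolyvagin's class `c_M(n)` is
# Selmer at every finite place `w ∤ n` of `K`, with NO Heegner-divisor input

Lead prover seat `bsd-line-fkl-p1` g13 (2026-08-28), `--supports stmt-BirchSwinnertonDyer-23715` (helper).  THEOREMS ONLY;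
no definition, no named fact introduced, no `sorry`; BSD is not proved by any of this.

The first-layer classes of the bottom rung (`FirstLayerClassesAtTwoBottomNeg`, fields `c₁_loc` / `c₂_loc`) need McCallum's
Lemma 4.3 = Gross's Prop. 6.2 (1) for Kolyvagin's class `c_M(n) ∈ H¹(K, E[2^M])` at EVERY finite place `w ∤ n` of `K`,
the places of BAD reduction included.  The tree's two roads to the bad places are typed `p ≠ 2`: the receptacle clause
`hGZ` from [GZ86, III (3.1)] (`Gross1991_heegnerPoint_sub_ratTorsion_mem_E0`, Gross-scoped) and Kodaira–Néron on (KN_p)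
(additive exponents `≤ 4` are prime to `p ≥ 5` only).  On the slice of the crux NEITHER is needed: every bad prime of
`E` SPLITS in the Heegner field `K`, so `c_w(E/K) = c_v(E/ℚ)` (`∏_w c_w(E/K) = (∏_v c_v(E))²`, tree
`X11b.tamagawaProduct_baseChange_eq_sq_of_allSplit`), and `∏_v c_v(E)` is ODD by hypothesis; the image of `c_M(n)` in
`H¹(K_w, E)` is an UNRAMIFIED class (`K[n]/K` is unramified at `w ∤ n`: inertia fixes `E(K[n]) ⊆ E(K̄_w)`), killed by
`c_w` (Milne *ADT* I Prop. 3.8, PROVED in the tree: `MilneTamagawa.Milne2006_localTamagawaNumber_smul_unramifiedClass_eq_zero_holds`)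
and by `2^M` (McCallum Lemma 4.1), hence zero (`TamagawaFreePlace.kolyvaginClass_mem_selmerLocalKer_of_inertia_of_localTamagawaNumber_smul`,
Gross's coprimality trick).  McCallum's standing inputs at `2` are the tree's: admissibility of `E(K[n]) ⊆ E(K̄)` for `2^M`
(`GenusExact.isAdmissible_pointsSubgroup_two_of_heegner`: `ρ̄_{E,2}` onto, Heegner + `d_K ≠ −4`) and the `Γ_K`-invariance of
`[P(n)]` mod `2^M` (`Prop44.toGeomPoints_derivedPoint_mem_invPoints`, Zhang–Kolyvagin levels of index `≥ M`).

Main theorem: `kolyvaginClass_two_mem_selmerLocalKer_of_odd_tamagawaProduct` — for `W/ℚ` globally minimal with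
`ρ_{W,2^k}` onto for all `k` and `∏ c_v(W)` odd, `K` imaginary quadratic with `d_K ∉ {−3, −4}` and the Heegner hypothesis for
`N_W`, a frame `(Dt, β, ι)`, a square-free `n` whose prime factors are Zhang–Kolyvagin primes at `2` of index `≥ M`, a datum
`d` of conductor `n` and a finite place `w ∤ n` of `K`: `c_M(n) = d.kolyvaginClass 2 M ∈ selmerLocalKer (W⁄K) K_w 2^M`.

References: [GrossLMS1991] §6 Prop. 6.2 (1) (pp. 244–245), Lemma 4.3, Prop. 3.6; [McCallumLMS1991] §4 Lemma 4.1, Cor. 4.2,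
Lemma 4.3, (4)–(6); [MilneADT2006] Ch. I Prop. 3.8; [JetchevSkinnerWan2017] §7.3.1 (eq:tamK); [WZhang2014] Notations (xii).
-/

set_option autoImplicit false
-- the Theorems namespace of this sub repeats the summit name by design (D-0017 nested layout)
set_option linter.dupNamespace false

noncomputable section

open scoped Classical

namespace Summit.BirchSwinnertonDyer.BirchSwinnertonDyer.Theorems.RankOneAtTwoOneDoor

open WeierstrassCurve NumberField IsDedekindDomain Field
  Literature.NumberTheory.EllipticCurves Literature.NumberTheory.EllipticCurves.ModularForms
  Literature.NumberTheory.GaloisRepresentations Literature.NumberTheory.EllipticCurves.KolyvaginCocycle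
  Summit.BirchSwinnertonDyer.Rank1Residual.X11b
  Summit.BirchSwinnertonDyer.BirchSwinnertonDyer.Theorems.GenusExact

/-! ### §1 Bookkeeping: local Tamagawa numbers of `E/K` are odd on the slice -/

/-- **A local Tamagawa number divides the Tamagawa product** (the product `∏ᶠ` is a finite product over the bad places).
[cite: SilvermanAEC2009, VII.6 Cor. 6.2 and VIII.1 Remark 1.3] -/
theorem localTamagawaNumber_dvd_tamagawaProduct {L : Type} [Field L] [NumberField L] (X : WeierstrassCurve L) [X.IsElliptic]
    (w : HeightOneSpectrum (𝓞 L)) :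
    (X.baseChange (w.adicCompletion L)).localTamagawaNumber (w.adicCompletionIntegers L) ∣ X.tamagawaProduct := by
  set c : HeightOneSpectrum (𝓞 L) → ℕ := fun u ↦
    (X.baseChange (u.adicCompletion L)).localTamagawaNumber (u.adicCompletionIntegers L) with hc
  have hfin : (Function.mulSupport c).Finite := X.mulSupport_localTamagawaNumber_finite_holds
  have hsub : Function.mulSupport c ⊆ (insert w hfin.toFinset : Finset _) := fun u hu ↦ by
    rw [Finset.coe_insert, Set.Finite.coe_toFinset]
    exact Set.mem_insert_of_mem _ hu
  have hprod : X.tamagawaProduct = ∏ u ∈ insert w hfin.toFinset, c u := by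
    rw [tamagawaProduct]
    exact finprod_eq_prod_of_mulSupport_subset c hsub
  rw [hprod]
  exact Finset.dvd_prod_of_mem c (Finset.mem_insert_self w _)

/-- **On the slice every local Tamagawa number of `E/K` is ODD**: the Heegner hypothesis splits every bad prime of `E` in
`K`, so `∏_w c_w(E/K) = (∏_v c_v(E))²` (`X11b.tamagawaProduct_baseChange_eq_sq_of_allSplit`), which is odd when
`∏_v c_v(E)` is; each `c_w` divides it. [cite: JetchevSkinnerWan2017, §7.3.1 (eq:tamK)] [cite: GrossLMS1991, §1 (1.2)] -/
theorem not_two_dvd_localTamagawaNumber_baseChange_of_odd_tamagawaProduct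
    (W : WeierstrassCurve ℚ) [W.IsElliptic] (hc : Odd W.tamagawaProduct)
    (K : Type) [Field K] [NumberField K] (hK : IsImaginaryQuadratic K)
    (hH : SatisfiesHeegnerHypothesis (W.conductorNorm ℤ) K) (w : HeightOneSpectrum (𝓞 K)) :
    ¬ 2 ∣ ((W.baseChange K).baseChange (w.adicCompletion K)).localTamagawaNumber (w.adicCompletionIntegers K) := by
  haveI : (W.baseChange K).IsElliptic := by rw [baseChange]; infer_instance
  have hsq : (W.baseChange K).tamagawaProduct = W.tamagawaProduct ^ 2 :=
    tamagawaProduct_baseChange_eq_sq_of_allSplit W K hK.1 fun ℓ _ hℓ ↦ hH ℓ Fact.out hℓ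
  have hodd : Odd (W.baseChange K).tamagawaProduct := by rw [hsq]; exact hc.pow
  intro h2
  exact (Nat.not_even_iff_odd.mpr hodd) (even_iff_two_dvd.mpr
    (h2.trans (localTamagawaNumber_dvd_tamagawaProduct (W.baseChange K) w)))

/-! ### §2 Local inertia away from `n` fixes `E(K[n]) ⊆ E(K̄)` -/

/-- **Local inertia at `w ∤ n` fixes `E(K[n]) ⊆ E(K̄)`** read through `res : Γ_{K_w} → Γ_K` (`K[n]/K` is unramified at
`w ∤ n`: `res(t)` fixes `d.emb (K[n])` pointwise, tree `KolyvaginH44.resGal_smul_algHom_ringClassField_eq_self`; `Γ_K` acts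
coordinatewise).  The geometric-points form of x11b3's `KolyvaginHloc.smul_pointsMap_toGeomPoints_eq_of_mem_localInertia`.
[cite: GrossLMS1991, Prop. 6.2 (1)] [cite: McCallumLMS1991, Lemma 4.3] -/
theorem resGal_smul_toGeomPoints_eq_of_mem_localInertia {N : ℕ} [NeZero N] {W : WeierstrassCurve ℚ}
    {K : Type} [Field K] [NumberField K] (hK : IsImaginaryQuadratic K) (ι : K →+* ℂ)
    {Dt : ModularParametrizationData W N} {β : ℤ} {n : ℕ} (hn : n ≠ 0) (d : KolyvaginHeegnerData Dt β ι n)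
    {w : HeightOneSpectrum (𝓞 K)} (hw : ((n : ℕ) : 𝓞 K) ∉ w.asIdeal)
    {𝔐 : Ideal (w.localAbsIntegers)} (h𝔐 : 𝔐 ∈ w.localPrimesAbove)
    {t : absoluteGaloisGroup (w.adicCompletion K)} (ht : t ∈ 𝔐.inertia (absoluteGaloisGroup (w.adicCompletion K)))
    (P : (W.baseChange (ringClassField K ι n)).toAffine.Point) :
    resGal (K := K) (w.adicCompletion K) t • d.toGeomPoints P = d.toGeomPoints P := by
  let e : ringClassField K ι n →ₐ[K] AlgebraicClosure K := { d.emb with commutes' := d.emb_apply }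
  have hfix : ∀ x : ringClassField K ι n, resGal (K := K) (w.adicCompletion K) t • d.emb x = d.emb x := fun x ↦
    KolyvaginH44.resGal_smul_algHom_ringClassField_eq_self hK ι hn e hw h𝔐 ht x
  rcases P with _ | ⟨x, y, hxy⟩
  · change resGal (K := K) (w.adicCompletion K) t • d.toGeomPoints 0 = d.toGeomPoints 0
    rw [map_zero, smul_zero]
  · have h1 : d.toGeomPoints (.some x y hxy) = Affine.Point.map (W' := W) d.emb.toRatAlgHom (.some x y hxy) := rfl
    rw [h1, Affine.Point.map_some]
    have hns : ((W.baseChange K).baseChange (AlgebraicClosure K)).toAffine.Nonsingular (d.emb x) (d.emb y) :=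
      (Affine.baseChange_nonsingular W d.emb.toRatAlgHom.injective x y).mpr hxy
    change Affine.Point.map (W' := W.baseChange K)
        ((show AlgebraicClosure K ≃ₐ[K] AlgebraicClosure K from resGal (K := K) (w.adicCompletion K) t) :
          AlgebraicClosure K →ₐ[K] AlgebraicClosure K)
        (Affine.Point.some (d.emb x) (d.emb y) hns) = Affine.Point.some (d.emb x) (d.emb y) hns
    rw [Affine.Point.map_some]
    simp only [Affine.Point.some.injEq, AlgEquiv.coe_toAlgHom]
    exact ⟨hfix x, hfix y⟩

/-! ### §3 Gross 6.2 (1) / McCallum Lemma 4.3 over `K` at `2` on the slice -/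

/-- **Gross 1991 Prop. 6.2 (1) / McCallum 1991 Lemma 4.3 over `K` at `p = 2` on the odd-Tamagawa slice, NO Heegner-divisor input.**
For `W/ℚ` globally minimal with `ρ_{W,2^k}` onto for every `k` and `∏_v c_v(W)` ODD, `K` imaginary quadratic with `d_K ∉ {−3, −4}`
satisfying the Heegner hypothesis for `N_W`, a frame `(Dt, β, ι)`, `n` square-free whose prime factors are Zhang–Kolyvagin primes at
`2` of index `≥ M`, a Kolyvagin–Heegner datum `d` of conductor `n`, and a finite place `w ∤ n` of `K`:
`c_M(n) ∈ selmerLocalKer (W⁄K) K_w 2^M`.  Proof: the image of `c_M(n)` in `H¹(K_w, E)` is unramified (§2) hence killed by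
`c_w(E/K)` (Milne I.3.8, tree theorem) which is odd (§1), and by `2^M`; McCallum's standing inputs at `2` are the tree's
(`isAdmissible_pointsSubgroup_two_of_heegner`, `Prop44.toGeomPoints_derivedPoint_mem_invPoints`).
[cite: GrossLMS1991, §6 Prop. 6.2 (1), pp. 244–245] [cite: McCallumLMS1991, §4 Lemma 4.3, Lemma 4.1] [cite: MilneADT2006, Ch. I Prop. 3.8] -/
theorem kolyvaginClass_two_mem_selmerLocalKer_of_odd_tamagawaProduct
    (W : WeierstrassCurve ℚ) [W.IsElliptic] [W.IsGloballyMinimal] [NeZero (W.conductorNorm ℤ)]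
    (hsurj : ∀ k : ℕ, W.HasSurjectiveModNGaloisRep ((2 ^ k : ℕ) : ℤ)) (hc : Odd W.tamagawaProduct)
    (K : Type) [Field K] [NumberField K] (hK : IsImaginaryQuadratic K)
    (hD3 : NumberField.discr K ≠ -3) (hD4 : NumberField.discr K ≠ -4)
    (hH : SatisfiesHeegnerHypothesis (W.conductorNorm ℤ) K)
    (Dt : ModularParametrizationData W (W.conductorNorm ℤ)) (β : ℤ) (ι : K →+* ℂ) (M : ℕ)
    {n : ℕ} (hn : Squarefree n)
    (hk : ∀ q ∈ n.primeFactors, Zhang2014.IsKolyvaginPrime (W.conductorNorm ℤ) W K 2 q ∧ M ≤ Zhang2014.kolyvaginIndex W 2 q)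
    (d : KolyvaginHeegnerData Dt β ι n) (w : HeightOneSpectrum (𝓞 K)) (hw : (n : 𝓞 K) ∉ w.asIdeal) :
    d.kolyvaginClass Nat.prime_two M ∈ selmerLocalKer (W.baseChange K) (w.adicCompletion K) ((2 ^ M : ℕ) : ℤ) := by
  haveI : (W.baseChange K).IsElliptic := by rw [baseChange]; infer_instance
  have hn0 : n ≠ 0 := hn.ne_zero
  have hD : NumberField.discr K < -4 := KolyvaginAssembly.discr_lt_neg_four hK ⟨hD3, hD4⟩
  -- McCallum's standing inputs at `2`
  have hA : IsAdmissible (absoluteGaloisGroup K) d.pointsSubgroup ((2 ^ M : ℕ) : ℤ) :=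
    isAdmissible_pointsSubgroup_two_of_heegner d hK hn0 hD4 hH hsurj M
  have hPt : d.toGeomPoints d.derivedPoint ∈ invPoints (absoluteGaloisGroup K) d.pointsSubgroup ((2 ^ M : ℕ) : ℤ) :=
    Prop44.toGeomPoints_derivedPoint_mem_invPoints hK ι hD hH Dt Nat.prime_two hn hk d
  rw [d.kolyvaginClass_of_admissible Nat.prime_two M hA hPt]
  -- a prime of the local absolute integers above `𝓂_w`
  obtain ⟨𝔐, h𝔐⟩ := w.localPrimesAbove_nonempty
  -- inertia fixes `P(n)`
  have hI : ∀ σ ∈ 𝔐.inertia (absoluteGaloisGroup (w.adicCompletion K)),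
      resGal (K := K) (w.adicCompletion K) σ • d.toGeomPoints d.derivedPoint = d.toGeomPoints d.derivedPoint :=
    fun σ hσ ↦ resGal_smul_toGeomPoints_eq_of_mem_localInertia hK ι hn0 d hw h𝔐 hσ _
  -- `gcd(2^M, c_w) = 1`
  have hcop : IsCoprime ((2 ^ M : ℕ) : ℤ)
      (((W.baseChange K).baseChange (w.adicCompletion K)).localTamagawaNumber (w.adicCompletionIntegers K) : ℤ) :=
    TamagawaFreePlace.isCoprime_pow_natCast_of_not_dvd Nat.prime_two M
      (not_two_dvd_localTamagawaNumber_baseChange_of_odd_tamagawaProduct W hc K hK hH w)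
  exact TamagawaFreePlace.kolyvaginClass_mem_selmerLocalKer_of_inertia_of_localTamagawaNumber_smul (W.baseChange K)
    hA hPt w hI hcop (fun f hf ↦ MilneTamagawa.Milne2006_localTamagawaNumber_smul_unramifiedClass_eq_zero_holds
      (W.baseChange K) w h𝔐 f hf)

end Summit.BirchSwinnertonDyer.BirchSwinnertonDyer.Theorems.RankOneAtTwoOneDoor

end
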